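import Summits.QuantumFields.YangMills.Theorems.UnitScaleTiltProp7HessWOfFibreCoreT3Rows
import Summits.QuantumFields.YangMills.Theorems.UnitScaleTiltProp7CurvedLandauCoreFibreFinalT3
import HarnessLib

/-!
# Route `UnitScaleTilt`, crux K1 «MinimiserStabilityRegPr» (stmt-QuantumFields-19200), lane α-P — THE HESS_W′ JUNCTION, FILE 2:
# the slice-gap row `κ·Σ_b‖D(b)‖² ≤ Σ_p‖ℒ_p(D)‖²` of ✓`PV3ESigmaUniform.isMinOn_regFibrePr_of_sliceRows_at` AS A THEOREM for chart points `e^{iD}W` on the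
# Landau-gauged (0.4)-FIBRE of a (14)-regular background `W`, from the route-R curved fibre core ✓`Prop7CurvedLandauCoreFibreFinalT3.relPoincare_on_fibre_T3`

Cell `ym3-torus`, D-0154 (3c) twin-width seat `ym-routeR-w3` (gen 3).  THEOREMS ONLY (0 `def`, 0 `sorry`); `--supports stmt-QuantumFields-19200`, count-neutral.
YM₃ on T³ is a ladder rung (R3), not the Clay problem; nothing here claims a stub, the crux, d = 4 or the mass gap.

THE POINT.  The α-P lane's E′∕EX reductions (✓`PV3ESigmaUniform`, ✓`Prop7LocMinOfSliceRows`) display, per competitor with chart coordinate `D` (Hermitian traceless,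
`‖D(b)‖ ≤ s`), the row HESS_W′: `κ·Σ_b‖D(b)‖² ≤ Σ_p‖ℒ_p(D)‖²` (`ℒ_p(D) = Z₁ + Z₂ − Z₃ − Z₄`, the linearised relative plaquette variable of `e^{iD}W` against `W(∂p)`).
The route-R fibre core proves, for ANY `W′` on `W`'s `(K−n)`-fold (0.4)-fibre with `‖W′ − W‖ ≤ ρ` bondwise and a divergence budget `Σ‖D^*_W(W′W^* − 1)‖²_HS ≤ δ′Σ‖W′W^* − 1‖² + Z′`,
`(¼ℓ⁻² − A′(δ′ + 24576ρ′² + 768(eℓ⁻²)²))Σ‖W′W^* − 1‖² − A′Z′ ≤ 4A′Σ_p‖W′(∂p)W(∂p)^* − 1‖²` (`A′ = 18 + 537600L⁴`, `ℓ = L^{K−n}`, `‖W′W^* − 1‖ ≤ ρ′`).  Read at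
`W′ = e^{iD}W` with FILE 1's rows (`W′W^* − 1 = iD + O(D²)`, `W′(∂p)W(∂p)^* − 1 = ℒ_p(D) + O(D²)`, divergence of the remainder a bounded stencil; the whole
divergence booked as `Z′`):
  `((1∕8)ℓ⁻² − A′(2δ + 321072s² + 1536(eℓ⁻²)²))·Σ_b‖D(b)‖² − 2A′Z ≤ 8A′·Σ_p‖ℒ_p(D)‖²`      (§1, budget `Σ_x‖D^*_W(iD)‖²_HS ≤ δΣ‖D‖² + Z`)
and, for `D` in the (linear) Landau gauge at `W` (`D^*_W(iD) = 0`) inside the window `4·10¹¹L⁹·(ℓs) ≤ 1`, `10¹⁴L⁹e ≤ 1`: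
  `(1∕(128A′))·ℓ⁻²·Σ_b‖D(b)‖² ≤ Σ_p‖ℒ_p(D)‖²`                                                  (§2)
— the HESS_W′ row with the `L`-only constant `κ₀ = 1∕(128(18 + 537600L⁴))` at its natural scaling `κ = κ₀ℓ⁻²` (✓`PV3ESigmaUniform.stub_PV3E_of_sliceRows`' shape),
k- and volume-uniform.

WHAT IS PROVED (ns `…Theorems.Prop7HessWOfFibreCoreT3`; T³, `SU(2)`).  §1 ★★★ `hessW_budget_of_fibre_T3`; §2 `window_T3` (the `L`-only arithmetic),
★★★ `hessW_curl_div_of_fibre_T3` (GAUGE-FREE, (116) currency: `κ₀ℓ⁻²Σ‖D‖² ≤ Σ_p‖ℒ_p(D)‖² + ¼Σ_x‖D^*_W(iD)‖²_HS` for every chart point on the fibre),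
★★★ `hessW_of_landau_fibre_T3` (Landau-gauged: the `hq` row verbatim); §3 ★★ `hessW_curl_div_of_mem_fibre_T3` (the (116) form in the membership letters
`W ∈ regFibrePr(e, V)`, `e^{iD}W ∈ fibre V`).

HONEST SCOPE.  Two files of bookkeeping over the landed fibre core and the landed chart rows; no recursion family, no per-level datum, no N06 input displayed.  The rows are
proved for chart points on the EXACT (0.4)-fibre through `W` (`hfib`) — SUBSPACE∕slice statements at the background, not statements about the quotient by the pinned group,
and not stub P; nothing here closes an item.  SLICE BOOKKEEPING (located, not proved here): a competitor's gauge orbit meets the exact fibre in an orbit of the pinned group (4);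
the FULL linear Landau condition `D^*_W(iD) = 0` of the last corollary spends the coarse gauge freedom a second time, so {exact fibre} ∩ {full Landau} is thinner than a section
of the competitors by the dimension of the coarse gauge group — that corollary is the `hq` row on the «Landau subspace» of 1-forms (numerically the most coercive space,
★p1 g12 2026-08-28), not a chart of all competitors.  Sections are print's slice ((20) ∧ (21) = `R(U₀)D^*A = 0`, [Balaban1985RegularSpaces] (1.38): divergence
coarse-harmonic, NOT budget-small a priori; and COV's chart point sits on the Σ-twisted fibre (1.37)^cov, ✓`Prop7ChartSigmaT3`, so `hfib` holds only after the
(1.29)-restricted re-gauging `(e^{iX}W)^u ∈ 𝔅_k(V)`) and the pinned point-Landau representative (✓`Prop7PointLandauBudget.sum_hs_divB_le_of_pinnedOpt`: `δ = 6ρ²` plus a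
centre debit `Z`); for those the operative statements are §1 (budget form) and the gauge-free (116) form of §2, with the divergence term DISPLAYED for the consumer.  Whether
CHART_W delivers every admissible competitor inside this window with a curl-absorbable divergence term is the chart supplier's ∕ the lane's business, not this file's.

References: T. Bałaban, CMP 102 (1985) 277–309 [Balaban1985Variational] ((14)–(15) p.280, (19)–(22) p.281, (116) p.295, (141)–(143) p.299); CMP 99 (1985) 389–434
[Balaban1985BackgroundPropagators] ((3.8) p.392, Thm 3.11 p.416); CMP 99 (1985) 75–102 [Balaban1985RegularSpaces] ((1.28)–(1.30) p.81, (1.38) p.82, Thm 2 p.83).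
-/

set_option autoImplicit false

noncomputable section

open scoped BigOperators Matrix.Norms.L2Operator Matrix

namespace Summit.QuantumFields.YangMills.Theorems.Prop7HessWOfFibreCoreT3

open Literature.MathematicalPhysics.QuantumFieldTheory.Balaban1983to89
open Literature.MathematicalPhysics.QuantumFieldTheory.Balaban1983to89.T3ContinuumYM3Torus
open Literature.MathematicalPhysics.QuantumFieldTheory.Balaban1983to89.T3SectALandauChart (emb15 pos_of_regPr)
open Literature.MathematicalPhysics.QuantumFieldTheory.Balaban1983to89.T3UnitLawDensityEML (ℰp)
open Literature.MathematicalPhysics.QuantumFieldTheory.Balaban1983to89.T3ConstrainedMinimiser (fibre)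
open Literature.MathematicalPhysics.QuantumFieldTheory.Balaban1983to89.T3RegularMinimiser (regThreshold)
open Literature.MathematicalPhysics.QuantumFieldTheory.Balaban1983to89.T3PrintedRegularMinimiser (RegPr regFibrePr mem_regFibrePr_iff)
open Finset T4Continuum BlockAveraging AveragingRT ExpMeanLog BlockAveragingEMLLinearised BlockAveragingEMLLinearisedBackground BlockAveragingEMLProp2 B1RG242Torus
open B9Eq39Adjoint (divB)
open B10Eq27TorusAxialLog (unitsField toUField)
open B9TorusCalculus (torusT)
open Summit.QuantumFields.YangMills.Theorems.Prop7TPrint (expHermField)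
open Summit.QuantumFields.YangMills.Theorems.Prop7CurvedLandauKnitT3 (three_le_L)
open Summit.QuantumFields.YangMills.Theorems.Prop7CurvedLandauCoreFibreFinalT3 (relPoincare_on_fibre_T3)
open Summit.QuantumFields.YangMills.Theorems.Prop7AxialLemma1 (iter_eq_of_mem_fibre)
open Summit.QuantumFields.YangMills.Theorems.Prop7HessWOfFibreCoreT3Rows

/-! ## §1 ★★★ HESS_W′ with a divergence budget: the fibre core read at the chart point `e^{iD}W` -/

set_option maxHeartbeats 400000 in
/-- ★★★ **THE SLICE-GAP ROW AT A (14)-REGULAR BACKGROUND, BUDGET FORM.**  `W ∈ SU(2)` on the finest torus of run `K` with `dist1(W(∂p)) ≤ e·ℓ⁻²` (`ℓ = L^{K−n}`,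
`0 < e`, `10¹⁴L⁹e ≤ 1`); `D` Hermitian traceless with `‖D(b)‖ ≤ s`, `0 ≤ s`, `4·10¹¹·L⁹·(ℓs) ≤ 1`; the chart point ON THE FIBRE, `(e^{iD}W)‾^{(K−n)} = W̄^{(K−n)}`; a divergence
budget `Σ_xΣ_jk|(D^*_W(iD))(x)_jk|² ≤ δ·Σ_b‖D(b)‖² + Z`.  THEN
`((1∕8)ℓ⁻² − (18 + 537600L⁴)(2δ + 321072s² + 1536(eℓ⁻²)²))·Σ_b‖D(b)‖² − 2(18 + 537600L⁴)·Z ≤ 8(18 + 537600L⁴)·Σ_p‖ℒ_p(D)‖²`.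
[cite: Balaban1985Variational, (116) p.295, (141)-(143) p.299, (14)-(15) p.280; Balaban1985BackgroundPropagators, Thm 3.11 p.416; Balaban1985RegularSpaces, (1.28)-(1.30) p.81] -/
theorem hessW_budget_of_fibre_T3 (F : T3Family) (n K : ℕ)
    (W : GaugeField (F.P K) 0 (Matrix.specialUnitaryGroup (Fin 2) ℂ)) {e : ℝ} (he : 0 < e) (heL : 100000000000000 * (F.L : ℝ) ^ 9 * e ≤ 1)
    (hU : ∀ p : Plaq (F.P K) 0, dist1 (GaugeField.plaqHol W p) ≤ e * (((F.L : ℝ) ^ (K - n)) ^ 2)⁻¹)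
    (D : PBond (F.P K) 0 → Matrix (Fin 2) (Fin 2) ℂ) (hD : ∀ b : PBond (F.P K) 0, (D b).IsHermitian ∧ Matrix.trace (D b) = 0)
    {s : ℝ} (hs0 : 0 ≤ s) (hs : ∀ b : PBond (F.P K) 0, ‖D b‖ ≤ s) (hsL : 400000000000 * (F.L : ℝ) ^ 9 * (((F.L : ℝ) ^ (K - n)) * s) ≤ 1)
    (hfib : Averaging.iter (fun i => blockAvg (P := (F.P K)) (j := i) (expMeanLogSU (n := Fin 2))) (K - n) (emb15 W (expHermField D))
      = Averaging.iter (fun i => blockAvg (P := (F.P K)) (j := i) (expMeanLogSU (n := Fin 2))) (K - n) W)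
    {δ Z : ℝ}
    (hdiv : (∑ x : Site (F.P K) 0, ∑ j : Fin 2, ∑ k : Fin 2,
        ‖(divB (torusT (F.P K) 0) (fun κ z => unitsField (toUField W) ⟨z, κ⟩) (fun κ z => Complex.I • D ⟨z, κ⟩) x) j k‖ ^ 2)
      ≤ δ * (∑ b : PBond (F.P K) 0, ‖D b‖ ^ 2) + Z) :
    ((1 / 8) * ((((F.L : ℝ) ^ (K - n))) ^ 2)⁻¹
        - (18 + 537600 * (F.L : ℝ) ^ 4) * (2 * δ + 321072 * s ^ 2 + 1536 * (e * ((((F.L : ℝ) ^ (K - n))) ^ 2)⁻¹) ^ 2)) * (∑ b : PBond (F.P K) 0, ‖D b‖ ^ 2)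
      - 2 * (18 + 537600 * (F.L : ℝ) ^ 4) * Z
      ≤ 8 * (18 + 537600 * (F.L : ℝ) ^ 4) * ∑ p : Plaq (F.P K) 0, ‖((Complex.I • D ⟨p.src, p.μ⟩) + ((W ⟨p.src, p.μ⟩ : Matrix (Fin 2) (Fin 2) ℂ) * (Complex.I • D ⟨p.src.shift p.μ, p.ν⟩) * star (W ⟨p.src, p.μ⟩ : Matrix (Fin 2) (Fin 2) ℂ))
            - (((W ⟨p.src, p.μ⟩ * W ⟨p.src.shift p.μ, p.ν⟩ * (W ⟨p.src.shift p.ν, p.μ⟩)⁻¹ : Matrix.specialUnitaryGroup (Fin 2) ℂ) : Matrix (Fin 2) (Fin 2) ℂ) * (Complex.I • D ⟨p.src.shift p.ν, p.μ⟩) * star ((W ⟨p.src, p.μ⟩ * W ⟨p.src.shift p.μ, p.ν⟩ * (W ⟨p.src.shift p.ν, p.μ⟩)⁻¹ : Matrix.specialUnitaryGroup (Fin 2) ℂ) : Matrix (Fin 2) (Fin 2) ℂ))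
            - (((GaugeField.plaqHol W p : Matrix.specialUnitaryGroup (Fin 2) ℂ) : Matrix (Fin 2) (Fin 2) ℂ) * (Complex.I • D ⟨p.src, p.ν⟩) * star ((GaugeField.plaqHol W p : Matrix.specialUnitaryGroup (Fin 2) ℂ) : Matrix (Fin 2) (Fin 2) ℂ)))‖ ^ 2 := by
  -- scalars
  have hL3 : (3 : ℝ) ≤ (F.L : ℝ) := three_le_L F
  set ℓ : ℝ := (F.L : ℝ) ^ (K - n) with hℓ
  have hℓ1 : 1 ≤ ℓ := one_le_pow₀ (by linarith)
  have hL9 : (1 : ℝ) ≤ (F.L : ℝ) ^ 9 := one_le_pow₀ (by linarith)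
  have hℓs : ℓ * s ≤ 1 / 400000000000 := by
    have : ℓ * s ≤ (F.L : ℝ) ^ 9 * (ℓ * s) := le_mul_of_one_le_left (mul_nonneg (by linarith) hs0) hL9
    linarith
  have hs_small : s ≤ 1 / 400000000000 := by
    have : s ≤ ℓ * s := le_mul_of_one_le_left hs0 hℓ1
    linarith
  have hs4 : 4 * s ≤ 1 := by linarith
  have hs14 : ∀ b : PBond (F.P K) 0, ‖D b‖ ≤ 1 / 4 := fun b => (hs b).trans (by linarith)
  have h1 : ∀ b : PBond (F.P K) 0, ‖D b‖ ≤ 1 := fun b => (hs b).trans (by linarith)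
  set W' : GaugeField (F.P K) 0 (Matrix.specialUnitaryGroup (Fin 2) ℂ) := emb15 W (expHermField D) with hW'
  set SD : ℝ := ∑ b : PBond (F.P K) 0, ‖D b‖ ^ 2 with hSD
  set SY : ℝ := ∑ b : PBond (F.P K) 0, ‖pertVar W W' b‖ ^ 2 with hSY
  set A' : ℝ := 18 + 537600 * (F.L : ℝ) ^ 4 with hA'
  have hA'0 : 0 ≤ A' := by positivity
  have hSD0 : 0 ≤ SD := Finset.sum_nonneg fun _ _ => sq_nonneg _
  -- FILE 1 §2 dictionary, summed
  have hSY1 : SD ≤ 2 * SY := by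
    rw [hSD, hSY, Finset.mul_sum]; exact Finset.sum_le_sum fun b _ => normSq_D_le_two_normSq_pertVar W D b (hD b) (hs14 b)
  have hSY2 : SY ≤ 2 * SD := by
    rw [hSD, hSY, Finset.mul_sum]; exact Finset.sum_le_sum fun b _ => normSq_pertVar_le_two_normSq_D W D b (hD b) (hs14 b)
  have hδW : ∀ b : PBond (F.P K) 0, ‖pertVar W W' b‖ ≤ 2 * s := fun b =>
    (norm_pertVar_expChart_le W D b (hD b) (h1 b)).trans (by linarith [hs b])
  have hWsup : ∀ b : PBond (F.P K) 0, ‖((W' b : Matrix.specialUnitaryGroup (Fin 2) ℂ) : Matrix (Fin 2) (Fin 2) ℂ) - ((W b : Matrix.specialUnitaryGroup (Fin 2) ℂ) : Matrix (Fin 2) (Fin 2) ℂ)‖ ≤ 2 * s :=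
    fun b => (norm_expChart_sub_le W D b (hD b) (h1 b)).trans (by linarith [hs b])
  -- FILE 1 §3: the divergence of `Y = W′W^* − 1`, all of it booked as `Z′`
  have hdivY := sum_hs_divB_pertVar_le_of_budget W D hD hs (by linarith) hdiv
  have hdivY' : (∑ x : Site (F.P K) 0, ∑ j : Fin 2, ∑ k : Fin 2,
        ‖(divB (torusT (F.P K) 0) (fun κ z => unitsField (toUField W) ⟨z, κ⟩) (fun κ z => pertVar W W' ⟨z, κ⟩) x) j k‖ ^ 2)
      ≤ 0 * (∑ b : PBond (F.P K) 0, ‖pertVar W W' b‖ ^ 2) + ((2 * δ + 48 * s ^ 2) * SD + 2 * Z) := by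
    rw [zero_mul, zero_add]; exact hdivY
  -- the fibre core (F5, (ii′) currency) at `U₀ := W`, competitor `W′`
  have hρ : 200000000000 * (F.L : ℝ) ^ 9 * (((F.L : ℝ) ^ (K - n)) * (2 * s)) ≤ 1 := by
    have e1 : 200000000000 * (F.L : ℝ) ^ 9 * (((F.L : ℝ) ^ (K - n)) * (2 * s)) = 400000000000 * (F.L : ℝ) ^ 9 * (((F.L : ℝ) ^ (K - n)) * s) := by ring
    rw [e1]; exact hsL
  have hF5 := relPoincare_on_fibre_T3 F n K W W' he heL hU hfib hdivY' (by positivity : (0 : ℝ) ≤ 2 * s) hρ hWsup hδW (by linarith)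
  -- FILE 1 §1: the relative plaquettes against `ℒ_p`
  have hRP := sum_normSq_relPlaq_expChart_le W D hD hs hs4
  -- bookkeeping
  set LP : ℝ := ∑ p : Plaq (F.P K) 0, ‖((Complex.I • D ⟨p.src, p.μ⟩) + ((W ⟨p.src, p.μ⟩ : Matrix (Fin 2) (Fin 2) ℂ) * (Complex.I • D ⟨p.src.shift p.μ, p.ν⟩) * star (W ⟨p.src, p.μ⟩ : Matrix (Fin 2) (Fin 2) ℂ))
            - (((W ⟨p.src, p.μ⟩ * W ⟨p.src.shift p.μ, p.ν⟩ * (W ⟨p.src.shift p.ν, p.μ⟩)⁻¹ : Matrix.specialUnitaryGroup (Fin 2) ℂ) : Matrix (Fin 2) (Fin 2) ℂ) * (Complex.I • D ⟨p.src.shift p.ν, p.μ⟩) * star ((W ⟨p.src, p.μ⟩ * W ⟨p.src.shift p.μ, p.ν⟩ * (W ⟨p.src.shift p.ν, p.μ⟩)⁻¹ : Matrix.specialUnitaryGroup (Fin 2) ℂ) : Matrix (Fin 2) (Fin 2) ℂ))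
            - (((GaugeField.plaqHol W p : Matrix.specialUnitaryGroup (Fin 2) ℂ) : Matrix (Fin 2) (Fin 2) ℂ) * (Complex.I • D ⟨p.src, p.ν⟩) * star ((GaugeField.plaqHol W p : Matrix.specialUnitaryGroup (Fin 2) ℂ) : Matrix (Fin 2) (Fin 2) ℂ)))‖ ^ 2 with hLP
  set RP : ℝ := ∑ p : Plaq (F.P K) 0, ‖((GaugeField.plaqHol W' p : Matrix.specialUnitaryGroup (Fin 2) ℂ) : Matrix (Fin 2) (Fin 2) ℂ)
        * star ((GaugeField.plaqHol W p : Matrix.specialUnitaryGroup (Fin 2) ℂ) : Matrix (Fin 2) (Fin 2) ℂ) - 1‖ ^ 2 with hRP'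
  have hjunk0 : 0 ≤ A' * (24576 * (2 * s) ^ 2 + 768 * (e * (ℓ ^ 2)⁻¹) ^ 2) := by positivity
  have j1 : (1 / 4) * (ℓ ^ 2)⁻¹ * SD ≤ (1 / 4) * (ℓ ^ 2)⁻¹ * (2 * SY) := mul_le_mul_of_nonneg_left hSY1 (by positivity)
  have j2 : A' * (24576 * (2 * s) ^ 2 + 768 * (e * (ℓ ^ 2)⁻¹) ^ 2) * SY ≤ A' * (24576 * (2 * s) ^ 2 + 768 * (e * (ℓ ^ 2)⁻¹) ^ 2) * (2 * SD) :=
    mul_le_mul_of_nonneg_left hSY2 hjunk0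
  have j3 : 4 * RP ≤ 4 * (2 * LP + 31104 * s ^ 2 * SD) := by linarith
  have hA4 : A' * (4 * RP) ≤ A' * (4 * (2 * LP + 31104 * s ^ 2 * SD)) := mul_le_mul_of_nonneg_left j3 hA'0
  have e1 : ((1 / 4) * (ℓ ^ 2)⁻¹ - A' * 0 - A' * (24576 * (2 * s) ^ 2 + 768 * (e * (ℓ ^ 2)⁻¹) ^ 2)) * SY - A' * ((2 * δ + 48 * s ^ 2) * SD + 2 * Z)
      = (1 / 4) * (ℓ ^ 2)⁻¹ * SY - A' * (24576 * (2 * s) ^ 2 + 768 * (e * (ℓ ^ 2)⁻¹) ^ 2) * SY - A' * (2 * δ + 48 * s ^ 2) * SD - 2 * A' * Z := by ring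
  rw [e1] at hF5
  have e2 : ((1 / 8) * (ℓ ^ 2)⁻¹ - A' * (2 * δ + 321072 * s ^ 2 + 1536 * (e * (ℓ ^ 2)⁻¹) ^ 2)) * SD - 2 * A' * Z
      = (1 / 8) * (ℓ ^ 2)⁻¹ * SD - A' * (24576 * (2 * s) ^ 2 + 768 * (e * (ℓ ^ 2)⁻¹) ^ 2) * (2 * SD) - A' * (2 * δ + 48 * s ^ 2) * SD - 2 * A' * Z
          - A' * (4 * (31104 * s ^ 2 * SD)) := by ring
  rw [e2]
  linarith [hF5, j1, j2, hA4]

/-! ## §2 ★★★ HESS_W′ on the Landau-gauged fibre: the `hq` row with `κ = (1∕(128(18 + 537600L⁴)))·ℓ⁻²` -/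

/-- The window arithmetic: `L ≥ 3`, `ℓ = L^{K−n} ≥ 1`, `4·10¹¹L⁹(ℓs) ≤ 1`, `10¹⁴L⁹e ≤ 1`, `0 ≤ s`, `0 < e` ⟹ `(18 + 537600L⁴)·(321072s² + 1536(eℓ⁻²)²) ≤ (1∕16)ℓ⁻²`. [folklore] -/
theorem window_T3 (F : T3Family) (n K : ℕ) {e s : ℝ} (he : 0 < e) (heL : 100000000000000 * (F.L : ℝ) ^ 9 * e ≤ 1) (hs0 : 0 ≤ s)
    (hsL : 400000000000 * (F.L : ℝ) ^ 9 * (((F.L : ℝ) ^ (K - n)) * s) ≤ 1) :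
    (18 + 537600 * (F.L : ℝ) ^ 4) * (321072 * s ^ 2 + 1536 * (e * ((((F.L : ℝ) ^ (K - n))) ^ 2)⁻¹) ^ 2)
      ≤ (1 / 16) * ((((F.L : ℝ) ^ (K - n))) ^ 2)⁻¹ := by
  have hL3 : (3 : ℝ) ≤ (F.L : ℝ) := three_le_L F
  set L : ℝ := (F.L : ℝ) with hLdef
  set ℓ : ℝ := L ^ (K - n) with hℓ
  have hL1 : 1 ≤ L := by linarith
  have hℓ1 : 1 ≤ ℓ := one_le_pow₀ hL1
  have hℓ0 : 0 < ℓ := by linarith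
  have hL4 : 1 ≤ L ^ 4 := one_le_pow₀ hL1
  have hL9 : L ^ 4 ≤ L ^ 9 := pow_le_pow_right₀ hL1 (by norm_num)
  have hA0 : 0 ≤ 18 + 537600 * L ^ 4 := by positivity
  have hA : 18 + 537600 * L ^ 4 ≤ 537618 * L ^ 4 := by linarith
  -- `t = ℓs`: `L⁴·t ≤ L⁹·t ≤ 1/(4·10¹¹)`, `t ≤ 1/(4·10¹¹)`
  set t : ℝ := ℓ * s with ht
  have ht0 : 0 ≤ t := mul_nonneg hℓ0.le hs0
  have hL9t : L ^ 9 * t ≤ 1 / 400000000000 := by linarith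
  have hL4t : L ^ 4 * t ≤ 1 / 400000000000 := (mul_le_mul_of_nonneg_right hL9 ht0).trans hL9t
  have ht1 : t ≤ 1 / 400000000000 := by
    have : t ≤ L ^ 4 * t := le_mul_of_one_le_left ht0 hL4; linarith
  -- `e`: `L⁴e ≤ L⁹e ≤ 10⁻¹⁴`, `e ≤ 10⁻¹⁴`
  have hL9e : L ^ 9 * e ≤ 1 / 100000000000000 := by linarith
  have hL4e : L ^ 4 * e ≤ 1 / 100000000000000 := (mul_le_mul_of_nonneg_right hL9 he.le).trans hL9e
  have he1 : e ≤ 1 / 100000000000000 := by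
    have : e ≤ L ^ 4 * e := le_mul_of_one_le_left he.le hL4; linarith
  have hi0 : 0 ≤ (ℓ ^ 2)⁻¹ := by positivity
  have hi1 : (ℓ ^ 2)⁻¹ ≤ 1 := inv_le_one_of_one_le₀ (one_le_pow₀ hℓ1)
  -- the `s²` term: `s = tℓ⁻¹`, `A′·321072·t² ≤ 537618·321072·(L⁴t)·t ≤ 1/32`
  have hs_eq : s = t * ℓ⁻¹ := by rw [ht]; field_simp
  have key1 : (18 + 537600 * L ^ 4) * (321072 * t ^ 2) ≤ 1 / 32 := by
    have h1 : (18 + 537600 * L ^ 4) * (321072 * t ^ 2) ≤ 537618 * 321072 * ((L ^ 4 * t) * t) := by nlinarith [sq_nonneg t]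
    have h2 : (L ^ 4 * t) * t ≤ (1 / 400000000000) * (1 / 400000000000) := mul_le_mul hL4t ht1 ht0 (by norm_num)
    nlinarith [h1, h2]
  have hs_term : (18 + 537600 * L ^ 4) * (321072 * s ^ 2) ≤ (1 / 32) * (ℓ ^ 2)⁻¹ := by
    have e1 : (18 + 537600 * L ^ 4) * (321072 * s ^ 2) = ((18 + 537600 * L ^ 4) * (321072 * t ^ 2)) * (ℓ ^ 2)⁻¹ := by
      rw [hs_eq]; field_simp
    rw [e1]
    exact mul_le_mul_of_nonneg_right key1 hi0
  -- the `e²` term: `A′·1536·e²·ℓ⁻⁴ ≤ 537618·1536·(L⁴e)·e·ℓ⁻² ≤ (1/32)ℓ⁻²`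
  have key2 : (18 + 537600 * L ^ 4) * (1536 * e ^ 2) ≤ 1 / 32 := by
    have h1 : (18 + 537600 * L ^ 4) * (1536 * e ^ 2) ≤ 537618 * 1536 * ((L ^ 4 * e) * e) := by nlinarith [sq_nonneg e]
    have h2 : (L ^ 4 * e) * e ≤ (1 / 100000000000000) * (1 / 100000000000000) := mul_le_mul hL4e he1 he.le (by norm_num)
    nlinarith [h1, h2]
  have he_term : (18 + 537600 * L ^ 4) * (1536 * (e * (ℓ ^ 2)⁻¹) ^ 2) ≤ (1 / 32) * (ℓ ^ 2)⁻¹ := by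
    have e1 : (18 + 537600 * L ^ 4) * (1536 * (e * (ℓ ^ 2)⁻¹) ^ 2) = ((18 + 537600 * L ^ 4) * (1536 * e ^ 2)) * (ℓ ^ 2)⁻¹ * (ℓ ^ 2)⁻¹ := by ring
    rw [e1]
    have hk0 : 0 ≤ (18 + 537600 * L ^ 4) * (1536 * e ^ 2) * (ℓ ^ 2)⁻¹ := by positivity
    calc (18 + 537600 * L ^ 4) * (1536 * e ^ 2) * (ℓ ^ 2)⁻¹ * (ℓ ^ 2)⁻¹ ≤ (18 + 537600 * L ^ 4) * (1536 * e ^ 2) * (ℓ ^ 2)⁻¹ * 1 :=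
          mul_le_mul_of_nonneg_left hi1 hk0
      _ = (18 + 537600 * L ^ 4) * (1536 * e ^ 2) * (ℓ ^ 2)⁻¹ := mul_one _
      _ ≤ (1 / 32) * (ℓ ^ 2)⁻¹ := mul_le_mul_of_nonneg_right key2 hi0
  rw [mul_add]
  linarith

set_option maxHeartbeats 400000 in
/-- ★★★ **HESS_W′ IN THE (116) CURRENCY — GAUGE-FREE**: for EVERY chart point `e^{iD}W` on the (0.4)-fibre of a (14)-regular `W` inside the window (`dist1(W(∂p)) ≤ e·ℓ⁻²`,
`10¹⁴L⁹e ≤ 1`; `D` Hermitian traceless, `‖D(b)‖ ≤ s`, `4·10¹¹L⁹(ℓs) ≤ 1`; `(e^{iD}W)‾^{(K−n)} = W̄^{(K−n)}`), with NO gauge condition on `D`: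
`(1∕(128(18 + 537600L⁴)))·ℓ⁻²·Σ_b‖D(b)‖² ≤ Σ_p‖ℒ_p(D)‖² + ¼·Σ_xΣ_jk|(D^*_W(iD))(x)_jk|²` — the slice gap against print's full quadratic form (curl² + divergence²,
[Balaban1985BackgroundPropagators] Thm 3.11's `Δ_a`); the Landau-gauged case below drops the divergence term, a projected-Landau consumer ((21) = [Balaban1985RegularSpaces]
(1.38), `R(U₀)D^*A = 0`) keeps it displayed. [cite: Balaban1985Variational, (116) p.295, (21) p.281; Balaban1985BackgroundPropagators, Thm 3.11 p.416; Balaban1985RegularSpaces, (1.38) p.82] -/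
theorem hessW_curl_div_of_fibre_T3 (F : T3Family) (n K : ℕ)
    (W : GaugeField (F.P K) 0 (Matrix.specialUnitaryGroup (Fin 2) ℂ)) {e : ℝ} (he : 0 < e) (heL : 100000000000000 * (F.L : ℝ) ^ 9 * e ≤ 1)
    (hU : ∀ p : Plaq (F.P K) 0, dist1 (GaugeField.plaqHol W p) ≤ e * (((F.L : ℝ) ^ (K - n)) ^ 2)⁻¹)
    (D : PBond (F.P K) 0 → Matrix (Fin 2) (Fin 2) ℂ) (hD : ∀ b : PBond (F.P K) 0, (D b).IsHermitian ∧ Matrix.trace (D b) = 0)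
    {s : ℝ} (hs0 : 0 ≤ s) (hs : ∀ b : PBond (F.P K) 0, ‖D b‖ ≤ s) (hsL : 400000000000 * (F.L : ℝ) ^ 9 * (((F.L : ℝ) ^ (K - n)) * s) ≤ 1)
    (hfib : Averaging.iter (fun i => blockAvg (P := (F.P K)) (j := i) (expMeanLogSU (n := Fin 2))) (K - n) (emb15 W (expHermField D))
      = Averaging.iter (fun i => blockAvg (P := (F.P K)) (j := i) (expMeanLogSU (n := Fin 2))) (K - n) W) :
    (1 / (128 * (18 + 537600 * (F.L : ℝ) ^ 4))) * ((((F.L : ℝ) ^ (K - n))) ^ 2)⁻¹ * (∑ b : PBond (F.P K) 0, ‖D b‖ ^ 2)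
      ≤ (∑ p : Plaq (F.P K) 0, ‖((Complex.I • D ⟨p.src, p.μ⟩) + ((W ⟨p.src, p.μ⟩ : Matrix (Fin 2) (Fin 2) ℂ) * (Complex.I • D ⟨p.src.shift p.μ, p.ν⟩) * star (W ⟨p.src, p.μ⟩ : Matrix (Fin 2) (Fin 2) ℂ))
            - (((W ⟨p.src, p.μ⟩ * W ⟨p.src.shift p.μ, p.ν⟩ * (W ⟨p.src.shift p.ν, p.μ⟩)⁻¹ : Matrix.specialUnitaryGroup (Fin 2) ℂ) : Matrix (Fin 2) (Fin 2) ℂ) * (Complex.I • D ⟨p.src.shift p.ν, p.μ⟩) * star ((W ⟨p.src, p.μ⟩ * W ⟨p.src.shift p.μ, p.ν⟩ * (W ⟨p.src.shift p.ν, p.μ⟩)⁻¹ : Matrix.specialUnitaryGroup (Fin 2) ℂ) : Matrix (Fin 2) (Fin 2) ℂ))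
            - (((GaugeField.plaqHol W p : Matrix.specialUnitaryGroup (Fin 2) ℂ) : Matrix (Fin 2) (Fin 2) ℂ) * (Complex.I • D ⟨p.src, p.ν⟩) * star ((GaugeField.plaqHol W p : Matrix.specialUnitaryGroup (Fin 2) ℂ) : Matrix (Fin 2) (Fin 2) ℂ)))‖ ^ 2)
        + (1 / 4) * (∑ x : Site (F.P K) 0, ∑ j : Fin 2, ∑ k : Fin 2,
            ‖(divB (torusT (F.P K) 0) (fun κ z => unitsField (toUField W) ⟨z, κ⟩) (fun κ z => Complex.I • D ⟨z, κ⟩) x) j k‖ ^ 2) := by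
  set DIV : ℝ := ∑ x : Site (F.P K) 0, ∑ j : Fin 2, ∑ k : Fin 2,
      ‖(divB (torusT (F.P K) 0) (fun κ z => unitsField (toUField W) ⟨z, κ⟩) (fun κ z => Complex.I • D ⟨z, κ⟩) x) j k‖ ^ 2 with hDIV
  have hdiv : DIV ≤ 0 * (∑ b : PBond (F.P K) 0, ‖D b‖ ^ 2) + DIV := by rw [zero_mul, zero_add]
  have h := hessW_budget_of_fibre_T3 F n K W he heL hU D hD hs0 hs hsL hfib hdiv
  have hw := window_T3 F n K he heL hs0 hsL
  simp only [mul_zero, zero_add] at h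
  set ℓ : ℝ := (F.L : ℝ) ^ (K - n) with hℓ
  set A' : ℝ := 18 + 537600 * (F.L : ℝ) ^ 4 with hA'
  set SD : ℝ := ∑ b : PBond (F.P K) 0, ‖D b‖ ^ 2 with hSD
  have hA'0 : 0 < A' := by positivity
  have hSD0 : 0 ≤ SD := Finset.sum_nonneg fun _ _ => sq_nonneg _
  have hcoef : (1 / 16) * (ℓ ^ 2)⁻¹ * SD ≤ ((1 / 8) * (ℓ ^ 2)⁻¹ - A' * (321072 * s ^ 2 + 1536 * (e * (ℓ ^ 2)⁻¹) ^ 2)) * SD :=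
    mul_le_mul_of_nonneg_right (by linarith) hSD0
  have h16 : (1 / 16) * (ℓ ^ 2)⁻¹ * SD - 2 * A' * DIV ≤ ((1 / 8) * (ℓ ^ 2)⁻¹ - A' * (321072 * s ^ 2 + 1536 * (e * (ℓ ^ 2)⁻¹) ^ 2)) * SD - 2 * A' * DIV := by linarith
  have h16' := h16.trans h
  have e1 : (1 / (128 * A')) * (ℓ ^ 2)⁻¹ * SD = (8 * A')⁻¹ * ((1 / 16) * (ℓ ^ 2)⁻¹ * SD) := by
    field_simp; ring
  rw [e1, inv_mul_le_iff₀ (by positivity)]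
  have e2 : 8 * A' * ((∑ p : Plaq (F.P K) 0, ‖((Complex.I • D ⟨p.src, p.μ⟩) + ((W ⟨p.src, p.μ⟩ : Matrix (Fin 2) (Fin 2) ℂ) * (Complex.I • D ⟨p.src.shift p.μ, p.ν⟩) * star (W ⟨p.src, p.μ⟩ : Matrix (Fin 2) (Fin 2) ℂ))
            - (((W ⟨p.src, p.μ⟩ * W ⟨p.src.shift p.μ, p.ν⟩ * (W ⟨p.src.shift p.ν, p.μ⟩)⁻¹ : Matrix.specialUnitaryGroup (Fin 2) ℂ) : Matrix (Fin 2) (Fin 2) ℂ) * (Complex.I • D ⟨p.src.shift p.ν, p.μ⟩) * star ((W ⟨p.src, p.μ⟩ * W ⟨p.src.shift p.μ, p.ν⟩ * (W ⟨p.src.shift p.ν, p.μ⟩)⁻¹ : Matrix.specialUnitaryGroup (Fin 2) ℂ) : Matrix (Fin 2) (Fin 2) ℂ))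
            - (((GaugeField.plaqHol W p : Matrix.specialUnitaryGroup (Fin 2) ℂ) : Matrix (Fin 2) (Fin 2) ℂ) * (Complex.I • D ⟨p.src, p.ν⟩) * star ((GaugeField.plaqHol W p : Matrix.specialUnitaryGroup (Fin 2) ℂ) : Matrix (Fin 2) (Fin 2) ℂ)))‖ ^ 2)
        + (1 / 4) * DIV)
      = 8 * A' * (∑ p : Plaq (F.P K) 0, ‖((Complex.I • D ⟨p.src, p.μ⟩) + ((W ⟨p.src, p.μ⟩ : Matrix (Fin 2) (Fin 2) ℂ) * (Complex.I • D ⟨p.src.shift p.μ, p.ν⟩) * star (W ⟨p.src, p.μ⟩ : Matrix (Fin 2) (Fin 2) ℂ))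
            - (((W ⟨p.src, p.μ⟩ * W ⟨p.src.shift p.μ, p.ν⟩ * (W ⟨p.src.shift p.ν, p.μ⟩)⁻¹ : Matrix.specialUnitaryGroup (Fin 2) ℂ) : Matrix (Fin 2) (Fin 2) ℂ) * (Complex.I • D ⟨p.src.shift p.ν, p.μ⟩) * star ((W ⟨p.src, p.μ⟩ * W ⟨p.src.shift p.μ, p.ν⟩ * (W ⟨p.src.shift p.ν, p.μ⟩)⁻¹ : Matrix.specialUnitaryGroup (Fin 2) ℂ) : Matrix (Fin 2) (Fin 2) ℂ))
            - (((GaugeField.plaqHol W p : Matrix.specialUnitaryGroup (Fin 2) ℂ) : Matrix (Fin 2) (Fin 2) ℂ) * (Complex.I • D ⟨p.src, p.ν⟩) * star ((GaugeField.plaqHol W p : Matrix.specialUnitaryGroup (Fin 2) ℂ) : Matrix (Fin 2) (Fin 2) ℂ)))‖ ^ 2)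
        + 2 * A' * DIV := by ring
  rw [e2]
  linarith

set_option maxHeartbeats 400000 in
/-- ★★★ **HESS_W′ ON THE LANDAU-GAUGED FIBRE** (the `hq` row of ✓`PV3ESigmaUniform.isMinOn_regFibrePr_of_sliceRows_at` with `κ := (1∕(128(18 + 537600L⁴)))·ℓ⁻²`, AS A THEOREM).
`W ∈ SU(2)` on the finest torus of run `K` with `dist1(W(∂p)) ≤ e·ℓ⁻²` (`0 < e`, `10¹⁴L⁹e ≤ 1`); `D` Hermitian traceless, `‖D(b)‖ ≤ s`, `0 ≤ s`, `4·10¹¹L⁹(ℓs) ≤ 1`; the chart point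
on the fibre, `(e^{iD}W)‾^{(K−n)} = W̄^{(K−n)}`; `D` in the Landau gauge at `W`, `D^*_W(iD) = 0` at every site.  THEN `(1∕(128(18 + 537600L⁴)))·ℓ⁻²·Σ_b‖D(b)‖² ≤ Σ_p‖ℒ_p(D)‖²`.
[cite: Balaban1985Variational, (116) p.295, (141)-(143) p.299; Balaban1985RegularSpaces, (1.28)-(1.30) p.81, Thm 2 p.83; Balaban1985BackgroundPropagators, Thm 3.11 p.416] -/
theorem hessW_of_landau_fibre_T3 (F : T3Family) (n K : ℕ)
    (W : GaugeField (F.P K) 0 (Matrix.specialUnitaryGroup (Fin 2) ℂ)) {e : ℝ} (he : 0 < e) (heL : 100000000000000 * (F.L : ℝ) ^ 9 * e ≤ 1)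
    (hU : ∀ p : Plaq (F.P K) 0, dist1 (GaugeField.plaqHol W p) ≤ e * (((F.L : ℝ) ^ (K - n)) ^ 2)⁻¹)
    (D : PBond (F.P K) 0 → Matrix (Fin 2) (Fin 2) ℂ) (hD : ∀ b : PBond (F.P K) 0, (D b).IsHermitian ∧ Matrix.trace (D b) = 0)
    {s : ℝ} (hs0 : 0 ≤ s) (hs : ∀ b : PBond (F.P K) 0, ‖D b‖ ≤ s) (hsL : 400000000000 * (F.L : ℝ) ^ 9 * (((F.L : ℝ) ^ (K - n)) * s) ≤ 1)
    (hfib : Averaging.iter (fun i => blockAvg (P := (F.P K)) (j := i) (expMeanLogSU (n := Fin 2))) (K - n) (emb15 W (expHermField D))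
      = Averaging.iter (fun i => blockAvg (P := (F.P K)) (j := i) (expMeanLogSU (n := Fin 2))) (K - n) W)
    (hLandau : ∀ x : Site (F.P K) 0, divB (torusT (F.P K) 0) (fun κ z => unitsField (toUField W) ⟨z, κ⟩) (fun κ z => Complex.I • D ⟨z, κ⟩) x = 0) :
    (1 / (128 * (18 + 537600 * (F.L : ℝ) ^ 4))) * ((((F.L : ℝ) ^ (K - n))) ^ 2)⁻¹ * (∑ b : PBond (F.P K) 0, ‖D b‖ ^ 2)
      ≤ ∑ p : Plaq (F.P K) 0, ‖((Complex.I • D ⟨p.src, p.μ⟩) + ((W ⟨p.src, p.μ⟩ : Matrix (Fin 2) (Fin 2) ℂ) * (Complex.I • D ⟨p.src.shift p.μ, p.ν⟩) * star (W ⟨p.src, p.μ⟩ : Matrix (Fin 2) (Fin 2) ℂ))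
            - (((W ⟨p.src, p.μ⟩ * W ⟨p.src.shift p.μ, p.ν⟩ * (W ⟨p.src.shift p.ν, p.μ⟩)⁻¹ : Matrix.specialUnitaryGroup (Fin 2) ℂ) : Matrix (Fin 2) (Fin 2) ℂ) * (Complex.I • D ⟨p.src.shift p.ν, p.μ⟩) * star ((W ⟨p.src, p.μ⟩ * W ⟨p.src.shift p.μ, p.ν⟩ * (W ⟨p.src.shift p.ν, p.μ⟩)⁻¹ : Matrix.specialUnitaryGroup (Fin 2) ℂ) : Matrix (Fin 2) (Fin 2) ℂ))
            - (((GaugeField.plaqHol W p : Matrix.specialUnitaryGroup (Fin 2) ℂ) : Matrix (Fin 2) (Fin 2) ℂ) * (Complex.I • D ⟨p.src, p.ν⟩) * star ((GaugeField.plaqHol W p : Matrix.specialUnitaryGroup (Fin 2) ℂ) : Matrix (Fin 2) (Fin 2) ℂ)))‖ ^ 2 := by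
  have hdiv : (∑ x : Site (F.P K) 0, ∑ j : Fin 2, ∑ k : Fin 2,
        ‖(divB (torusT (F.P K) 0) (fun κ z => unitsField (toUField W) ⟨z, κ⟩) (fun κ z => Complex.I • D ⟨z, κ⟩) x) j k‖ ^ 2)
      ≤ 0 * (∑ b : PBond (F.P K) 0, ‖D b‖ ^ 2) + 0 := by
    rw [zero_mul, zero_add]
    refine le_of_eq (Finset.sum_eq_zero fun x _ => ?_)
    rw [hLandau x]
    simp
  have h := hessW_budget_of_fibre_T3 F n K W he heL hU D hD hs0 hs hsL hfib hdiv
  have hw := window_T3 F n K he heL hs0 hsL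
  simp only [mul_zero, zero_add, sub_zero] at h
  set ℓ : ℝ := (F.L : ℝ) ^ (K - n) with hℓ
  set A' : ℝ := 18 + 537600 * (F.L : ℝ) ^ 4 with hA'
  set SD : ℝ := ∑ b : PBond (F.P K) 0, ‖D b‖ ^ 2 with hSD
  have hA'0 : 0 < A' := by positivity
  have hSD0 : 0 ≤ SD := Finset.sum_nonneg fun _ _ => sq_nonneg _
  -- `((1/8)ℓ⁻² − A′(…)) ≥ (1/16)ℓ⁻²`, so `(1/16)ℓ⁻²·SD ≤ 8A′·LP`
  have hcoef : (1 / 16) * (ℓ ^ 2)⁻¹ * SD ≤ ((1 / 8) * (ℓ ^ 2)⁻¹ - A' * (321072 * s ^ 2 + 1536 * (e * (ℓ ^ 2)⁻¹) ^ 2)) * SD :=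
    mul_le_mul_of_nonneg_right (by linarith) hSD0
  have h16 := hcoef.trans h
  have e1 : (1 / (128 * A')) * (ℓ ^ 2)⁻¹ * SD = (8 * A')⁻¹ * ((1 / 16) * (ℓ ^ 2)⁻¹ * SD) := by
    field_simp; ring
  rw [e1, inv_mul_le_iff₀ (by positivity)]
  linarith


/-! ## §3 The same in the knit's membership letters: `W ∈ (6)(e) ∩ 𝔅_k(V)`, `e^{iD}W ∈ 𝔅_k(V)` -/

set_option maxHeartbeats 400000 in
/-- ★★ **HESS_W′ IN THE (116) CURRENCY, MEMBERSHIP LETTERS**: `W ∈ regFibrePr(e, V)` (print's (6)(e) on the fibre of `V`, `10¹⁴L⁹e ≤ 1`), `D` Hermitian traceless with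
`‖D(b)‖ ≤ s`, `4·10¹¹L⁹(ℓs) ≤ 1`, and the chart point on the SAME fibre, `e^{iD}W ∈ 𝔅_k(V)` — then
`(1∕(128(18 + 537600L⁴)))·ℓ⁻²·Σ_b‖D(b)‖² ≤ Σ_p‖ℒ_p(D)‖² + ¼·Σ_xΣ_jk|(D^*_W(iD))(x)_jk|²` ((14) from `RegPr` by `regThreshold = e·ℓ⁻²`; `hfib` by ✓`Prop7AxialLemma1.iter_eq_of_mem_fibre`).
[cite: Balaban1985Variational, (6) p.278, (14) p.280, (116) p.295; Balaban1985BackgroundPropagators, Thm 3.11 p.416] -/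
theorem hessW_curl_div_of_mem_fibre_T3 (F : T3Family) {n K : ℕ} (h : n ≤ K) {e : ℝ}
    (V : GaugeField (F.P n) 0 (Matrix.specialUnitaryGroup (Fin 2) ℂ)) {W : GaugeField (F.P K) 0 (Matrix.specialUnitaryGroup (Fin 2) ℂ)}
    (hWe : W ∈ regFibrePr F n K h e V) (heL : 100000000000000 * (F.L : ℝ) ^ 9 * e ≤ 1)
    (D : PBond (F.P K) 0 → Matrix (Fin 2) (Fin 2) ℂ) (hD : ∀ b : PBond (F.P K) 0, (D b).IsHermitian ∧ Matrix.trace (D b) = 0)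
    {s : ℝ} (hs0 : 0 ≤ s) (hs : ∀ b : PBond (F.P K) 0, ‖D b‖ ≤ s) (hsL : 400000000000 * (F.L : ℝ) ^ 9 * (((F.L : ℝ) ^ (K - n)) * s) ≤ 1)
    (hW' : emb15 W (expHermField D) ∈ fibre F ℰp n K h V) :
    (1 / (128 * (18 + 537600 * (F.L : ℝ) ^ 4))) * ((((F.L : ℝ) ^ (K - n))) ^ 2)⁻¹ * (∑ b : PBond (F.P K) 0, ‖D b‖ ^ 2)
      ≤ (∑ p : Plaq (F.P K) 0, ‖((Complex.I • D ⟨p.src, p.μ⟩) + ((W ⟨p.src, p.μ⟩ : Matrix (Fin 2) (Fin 2) ℂ) * (Complex.I • D ⟨p.src.shift p.μ, p.ν⟩) * star (W ⟨p.src, p.μ⟩ : Matrix (Fin 2) (Fin 2) ℂ))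
            - (((W ⟨p.src, p.μ⟩ * W ⟨p.src.shift p.μ, p.ν⟩ * (W ⟨p.src.shift p.ν, p.μ⟩)⁻¹ : Matrix.specialUnitaryGroup (Fin 2) ℂ) : Matrix (Fin 2) (Fin 2) ℂ) * (Complex.I • D ⟨p.src.shift p.ν, p.μ⟩) * star ((W ⟨p.src, p.μ⟩ * W ⟨p.src.shift p.μ, p.ν⟩ * (W ⟨p.src.shift p.ν, p.μ⟩)⁻¹ : Matrix.specialUnitaryGroup (Fin 2) ℂ) : Matrix (Fin 2) (Fin 2) ℂ))
            - (((GaugeField.plaqHol W p : Matrix.specialUnitaryGroup (Fin 2) ℂ) : Matrix (Fin 2) (Fin 2) ℂ) * (Complex.I • D ⟨p.src, p.ν⟩) * star ((GaugeField.plaqHol W p : Matrix.specialUnitaryGroup (Fin 2) ℂ) : Matrix (Fin 2) (Fin 2) ℂ)))‖ ^ 2)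
        + (1 / 4) * (∑ x : Site (F.P K) 0, ∑ j : Fin 2, ∑ k : Fin 2,
            ‖(divB (torusT (F.P K) 0) (fun κ z => unitsField (toUField W) ⟨z, κ⟩) (fun κ z => Complex.I • D ⟨z, κ⟩) x) j k‖ ^ 2) := by
  obtain ⟨hWfib, hreg⟩ := (mem_regFibrePr_iff F).mp hWe
  have he0 : 0 < e := pos_of_regPr F hreg
  have hU : ∀ p : Plaq (F.P K) 0, dist1 (GaugeField.plaqHol W p) ≤ e * (((F.L : ℝ) ^ (K - n)) ^ 2)⁻¹ := fun p => by
    have hp := (hreg.1 p).le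
    unfold regThreshold at hp
    rwa [inv_pow, pow_mul'] at hp
  have hfib := iter_eq_of_mem_fibre F h hW' hWfib
  exact hessW_curl_div_of_fibre_T3 F n K W he0 heL hU D hD hs0 hs hsL hfib

end Summit.QuantumFields.YangMills.Theorems.Prop7HessWOfFibreCoreT3

end
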